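import Mathlib
import Summits.KontsevichZagierPeriods.Zeta5Search.StairTopLevels
import HarnessLib

/-!
# ζ(5) search — the STAIRCASE SAVING of the TOP ray family is a THEOREM (DENOM-LAW track D1, prover-d1, 2026-08-23)

HONEST FRAMING: systematic search; no irrationality claim unless certified.  Cell `pub-zeta5`, track «DENOM-LAW» (D1 = the
staircase theorem), seat `denom-prover-d1`.  Valuation bookkeeping of explicit rationals; every model exponent these bounds feed
stays `< 1` — NO irrationality content; Brown–Zudilin's records in print (0.86 / 0.86597135 conditional on their (28)) are UNMOVED.

THE TOP FAMILY.  `bTop s n = n·(3s+16; s+8, s+7, …, s+2)` is the linear ray `bLin ((s+2)n) (sn) n` (`CellKitRays`); with `t = s+2` it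
is the dual parameter ray `b(n·a_t)` of the diagonal family of directions `a_t = (7,13,9,12,11,15,17,12) + (t−8)·(1,…,1)`:
`t = 8` (`s = 6`) is the census's TOP_STAIR direction #1 `(7,13,9,12,11,15,17,12)` (dual ray `n·(34;14,…,8)`), `t = 9` (`s = 7`) is
TOP_STAIR #9 `(8,14,10,13,12,16,18,13)` (`n·(37;15,…,9)`) — `bTop_six_eq_bOfA`, `bTop_seven_eq_bOfA`.

THE STAIRCASE CELL.  On these rays the cell's OBSERVED staircase law (gen-2 g5, REPORT-gen2-g5 §4–§5d; lane audit
`ttrl/zeta5-calc/LADDER.md`: 0 violations, n ≤ 40) differs from Brown–Zudilin's own accounting (28)+(30) in exactly ONE level cell,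
`θ = p/n ∈ (t+6, t+7)` = `(s+8)n < p < (s+9)n`, where (28) charges `d_{(t+7)n}` twice (the pair forms `b₀−b₄−b₇ = b₀−b₅−b₆ = (t+7)n`)
and the staircase once: the staircase needs `v_p(Cas₇(b)) ≥ −3` there, (28)+(30) only `−4` (`P_n = ρ(b)·Cas₇(b)`, `ord_p ρ = 3`, `ν_p = 3`).
The exact audit has `v_p(Cas₇) = −3` at all 136 + 133 such primes with `n ≤ 40` (`s = 6, 7`).

THE THEOREM (`stairTop_cell`; BY NAME `stairTopFamilyCell_holds : StaircaseCells.StairTopFamilyCell`, `stairCellTS1_holds`,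
`stairCellTS9_holds`).  For every `s ≥ 2`, `n ≥ 1` and every prime `(s+8)n < p < (s+9)n`:  `v_p(Cas₇(bTop s n)) ≥ −3`.
PROOF = the tree's THEOREM LB (`ClusterValuation.casoratianClassBound_holds`, digit-free) + a scale-free CLASS-TYPE COVER of the cell
(p3 g6's machine `ClassTypeCover.{IsType, Cover, checkLB, casLB_ge_of_cover}`; ray facts and level lemmas in part I `StairTopLevels`): the residues `x < p` fall into 18 intervals cut by
integer affine forms in `(s·n, n, p)`, on each of which the class of `x` has a constant level type (at most three levels
`x < x+p < x+2p`); `checkLB` at `(A,B) = (−3,0)` gives `casLB ≥ −3`.  So on this family the observed 'new denominator law' at the top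
level IS the class bound — a kernel theorem for all `n`, not an observation.
-/

open Finset

namespace Summit.KontsevichZagierPeriods.Zeta5Search.StairTop

open Summit.KontsevichZagierPeriods.Zeta5Search.ClusterValuation
open Summit.KontsevichZagierPeriods.Zeta5Search.CasoratianValuation (InPolytope shift casoratian)
open Summit.KontsevichZagierPeriods.Zeta5Search.WedgeDictionary (dOf)
open Summit.KontsevichZagierPeriods.Zeta5Search.CellKit
open Summit.KontsevichZagierPeriods.Zeta5Search.ClassTypeCover
open Summit.KontsevichZagierPeriods.Zeta5Search.StaircaseCells (bTop StairTopFamilyCell StairCellTS1 StairCellTS9)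

/-! ## §3 The staircase cell `(s+8)n < p < (s+9)n`: the class-type cover (18 intervals, at most three levels) -/

section Cell

variable {s n p x : ℕ} [Fact p.Prime]

/-- `x + 2p ≤ b₀`, centre at level 1: type `[1, −5, 1]`, self-conjugate. -/
theorem iv0c (_hsn : 2 * n ≤ s * n) (_hA : s * n + 8 * n < p) (_hB : p < s * n + 9 * n) (hx : x < p)
    (_hhi : x + 2 * p ≤ 3 * (s * n) + 16 * n) (hc : 2 * x + 2 * p = 3 * (s * n) + 16 * n) :
    IsType (bTop s n) p x [1, -5, 1] true :=
  topType_eq 2 rfl hx (by omega) (by omega)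
    (levels_cons (ne_low (by omega)) <| levels_cons (ne_cen (by omega)) <| levels_cons (ne_high (by omega)) <| levels_nil _ _ _)
    (by omega)

/-- `x + 2p ≤ b₀`, off the centre: type `[1, −6, 1]`. -/
theorem iv0 (_hsn : 2 * n ≤ s * n) (_hA : s * n + 8 * n < p) (_hB : p < s * n + 9 * n) (hx : x < p)
    (_hhi : x + 2 * p ≤ 3 * (s * n) + 16 * n) (_hc : 2 * x + 2 * p ≠ 3 * (s * n) + 16 * n) :
    IsType (bTop s n) p x [1, -6, 1] false :=
  topType_ne 2 rfl hx (by omega) (by omega)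
    (levels_cons (ne_low (by omega)) <| levels_cons (ne_well (by omega)) <| levels_cons (ne_high (by omega)) <| levels_nil _ _ _)
    (by omega)

/-- `x + 2p > b₀`, `x + p ≤ (2s+8)n`: type `[1, −6]`. -/
theorem iv1 (_hsn : 2 * n ≤ s * n) (_hA : s * n + 8 * n < p) (_hB : p < s * n + 9 * n) (hx : x < p)
    (_hlo : 3 * (s * n) + 16 * n < x + 2 * p) (_hhi : x + p ≤ 2 * (s * n) + 8 * n) :
    IsType (bTop s n) p x [1, -6] false :=
  topType_ne 1 rfl hx (by omega) (by omega)
    (levels_cons (ne_low (by omega)) <| levels_cons (ne_well (by omega)) <| levels_nil _ _ _) (by omega)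

/-- `(2s+8)n < x + p ≤ (2s+9)n`: type `[1, −5]`. -/
theorem iv2 (_hsn : 2 * n ≤ s * n) (_hA : s * n + 8 * n < p) (_hB : p < s * n + 9 * n) (hx : x < p)
    (_hlo : 2 * (s * n) + 8 * n < x + p) (_hhi : x + p ≤ 2 * (s * n) + 9 * n) :
    IsType (bTop s n) p x [1, -5] false :=
  topType_ne 1 rfl hx (by omega) (by omega)
    (levels_cons (ne_low (by omega)) <| levels_cons (ne_u6 (by omega)) <| levels_nil _ _ _) (by omega)

/-- `(2s+9)n < x + p ≤ (2s+10)n`: type `[1, −4]`. -/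
theorem iv3 (_hsn : 2 * n ≤ s * n) (_hA : s * n + 8 * n < p) (_hB : p < s * n + 9 * n) (hx : x < p)
    (_hlo : 2 * (s * n) + 9 * n < x + p) (_hhi : x + p ≤ 2 * (s * n) + 10 * n) :
    IsType (bTop s n) p x [1, -4] false :=
  topType_ne 1 rfl hx (by omega) (by omega)
    (levels_cons (ne_low (by omega)) <| levels_cons (ne_u5 (by omega)) <| levels_nil _ _ _) (by omega)

/-- `(2s+10)n < x + p`, `x < (s+2)n`: type `[1, −3]`. -/
theorem iv4 (_hsn : 2 * n ≤ s * n) (_hA : s * n + 8 * n < p) (_hB : p < s * n + 9 * n) (hx : x < p)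
    (_hlo : 2 * (s * n) + 10 * n < x + p) (_hhi : x < s * n + 2 * n) :
    IsType (bTop s n) p x [1, -3] false :=
  topType_ne 1 rfl hx (by omega) (by omega)
    (levels_cons (ne_low (by omega)) <| levels_cons (ne_u4 (by omega)) <| levels_nil _ _ _) (by omega)

/-- `(s+2)n ≤ x`, `x + p ≤ (2s+11)n`: type `[0, −3]`. -/
theorem iv5 (_hsn : 2 * n ≤ s * n) (_hA : s * n + 8 * n < p) (_hB : p < s * n + 9 * n) (hx : x < p)
    (_hlo : s * n + 2 * n ≤ x) (_hhi : x + p ≤ 2 * (s * n) + 11 * n) :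
    IsType (bTop s n) p x [0, -3] false :=
  topType_ne 1 rfl hx (by omega) (by omega)
    (levels_cons (ne_d1 (by omega)) <| levels_cons (ne_u4 (by omega)) <| levels_nil _ _ _) (by omega)

/-- `(2s+11)n < x + p`, `x < (s+3)n`: type `[0, −2]`. -/
theorem iv6 (_hsn : 2 * n ≤ s * n) (_hA : s * n + 8 * n < p) (_hB : p < s * n + 9 * n) (hx : x < p)
    (_hlo : 2 * (s * n) + 11 * n < x + p) (_hhi : x < s * n + 3 * n) :
    IsType (bTop s n) p x [0, -2] false :=
  topType_ne 1 rfl hx (by omega) (by omega)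
    (levels_cons (ne_d1 (by omega)) <| levels_cons (ne_u3 (by omega)) <| levels_nil _ _ _) (by omega)

/-- `(s+3)n ≤ x`, `x + p ≤ (2s+12)n`: type `[−1, −2]` (a minimal multipole class, `E = −3`). -/
theorem iv7 (_hsn : 2 * n ≤ s * n) (_hA : s * n + 8 * n < p) (_hB : p < s * n + 9 * n) (hx : x < p)
    (_hlo : s * n + 3 * n ≤ x) (_hhi : x + p ≤ 2 * (s * n) + 12 * n) :
    IsType (bTop s n) p x [-1, -2] false :=
  topType_ne 1 rfl hx (by omega) (by omega)
    (levels_cons (ne_d2 (by omega)) <| levels_cons (ne_u3 (by omega)) <| levels_nil _ _ _) (by omega)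

/-- `(2s+12)n < x + p`, `x < (s+4)n`, self-conjugate (`2x + p = b₀`): type `[−1, −1]`, centred. -/
theorem iv8c (_hsn : 2 * n ≤ s * n) (_hA : s * n + 8 * n < p) (_hB : p < s * n + 9 * n) (hx : x < p)
    (_hlo : 2 * (s * n) + 12 * n < x + p) (_hhi : x < s * n + 4 * n) (hc : 2 * x + p = 3 * (s * n) + 16 * n) :
    IsType (bTop s n) p x [-1, -1] true :=
  topType_eq 1 rfl hx (by omega) (by omega)
    (levels_cons (ne_d2 (by omega)) <| levels_cons (ne_u2 (by omega)) <| levels_nil _ _ _) (by omega)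

/-- `(2s+12)n < x + p`, `x < (s+4)n`, not self-conjugate: type `[−1, −1]`. -/
theorem iv8 (_hsn : 2 * n ≤ s * n) (_hA : s * n + 8 * n < p) (_hB : p < s * n + 9 * n) (hx : x < p)
    (_hlo : 2 * (s * n) + 12 * n < x + p) (_hhi : x < s * n + 4 * n) (_hc : 2 * x + p ≠ 3 * (s * n) + 16 * n) :
    IsType (bTop s n) p x [-1, -1] false :=
  topType_ne 1 rfl hx (by omega) (by omega)
    (levels_cons (ne_d2 (by omega)) <| levels_cons (ne_u2 (by omega)) <| levels_nil _ _ _) (by omega)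

/-- `(s+4)n ≤ x`, `x + p ≤ (2s+13)n`: type `[−2, −1]` (a minimal multipole class, `E = −3`). -/
theorem iv9 (_hsn : 2 * n ≤ s * n) (_hA : s * n + 8 * n < p) (_hB : p < s * n + 9 * n) (hx : x < p)
    (_hlo : s * n + 4 * n ≤ x) (_hhi : x + p ≤ 2 * (s * n) + 13 * n) :
    IsType (bTop s n) p x [-2, -1] false :=
  topType_ne 1 rfl hx (by omega) (by omega)
    (levels_cons (ne_d3 (by omega)) <| levels_cons (ne_u2 (by omega)) <| levels_nil _ _ _) (by omega)

/-- `(2s+13)n < x + p`, `x < (s+5)n`: type `[−2, 0]`. -/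
theorem iv10 (_hsn : 2 * n ≤ s * n) (_hA : s * n + 8 * n < p) (_hB : p < s * n + 9 * n) (hx : x < p)
    (_hlo : 2 * (s * n) + 13 * n < x + p) (_hhi : x < s * n + 5 * n) :
    IsType (bTop s n) p x [-2, 0] false :=
  topType_ne 1 rfl hx (by omega) (by omega)
    (levels_cons (ne_d3 (by omega)) <| levels_cons (ne_u1 (by omega)) <| levels_nil _ _ _) (by omega)

/-- `(s+5)n ≤ x`, `x + p ≤ (2s+14)n`: type `[−3, 0]`. -/
theorem iv11 (_hsn : 2 * n ≤ s * n) (_hA : s * n + 8 * n < p) (_hB : p < s * n + 9 * n) (hx : x < p)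
    (_hlo : s * n + 5 * n ≤ x) (_hhi : x + p ≤ 2 * (s * n) + 14 * n) :
    IsType (bTop s n) p x [-3, 0] false :=
  topType_ne 1 rfl hx (by omega) (by omega)
    (levels_cons (ne_d4 (by omega)) <| levels_cons (ne_u1 (by omega)) <| levels_nil _ _ _) (by omega)

/-- `(2s+14)n < x + p`, `x < (s+6)n`: type `[−3, 1]`. -/
theorem iv12 (_hsn : 2 * n ≤ s * n) (_hA : s * n + 8 * n < p) (_hB : p < s * n + 9 * n) (hx : x < p)
    (_hlo : 2 * (s * n) + 14 * n < x + p) (_hhi : x < s * n + 6 * n) :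
    IsType (bTop s n) p x [-3, 1] false :=
  topType_ne 1 rfl hx (by omega) (by omega)
    (levels_cons (ne_d4 (by omega)) <| levels_cons (ne_high (by omega)) <| levels_nil _ _ _) (by omega)

/-- `(s+6)n ≤ x < (s+7)n`: type `[−4, 1]`. -/
theorem iv13 (_hsn : 2 * n ≤ s * n) (_hA : s * n + 8 * n < p) (_hB : p < s * n + 9 * n) (hx : x < p)
    (_hlo : s * n + 6 * n ≤ x) (_hhi : x < s * n + 7 * n) :
    IsType (bTop s n) p x [-4, 1] false :=
  topType_ne 1 rfl hx (by omega) (by omega)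
    (levels_cons (ne_d5 (by omega)) <| levels_cons (ne_high (by omega)) <| levels_nil _ _ _) (by omega)

/-- `(s+7)n ≤ x < (s+8)n`: type `[−5, 1]`. -/
theorem iv14 (_hsn : 2 * n ≤ s * n) (_hA : s * n + 8 * n < p) (_hB : p < s * n + 9 * n) (hx : x < p)
    (_hlo : s * n + 7 * n ≤ x) (_hhi : x < s * n + 8 * n) :
    IsType (bTop s n) p x [-5, 1] false :=
  topType_ne 1 rfl hx (by omega) (by omega)
    (levels_cons (ne_d6 (by omega)) <| levels_cons (ne_high (by omega)) <| levels_nil _ _ _) (by omega)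

/-- `(s+8)n ≤ x < p`: type `[−6, 1]`. -/
theorem iv15 (_hsn : 2 * n ≤ s * n) (_hA : s * n + 8 * n < p) (_hB : p < s * n + 9 * n) (hx : x < p)
    (_hlo : s * n + 8 * n ≤ x) :
    IsType (bTop s n) p x [-6, 1] false :=
  topType_ne 1 rfl hx (by omega) (by omega)
    (levels_cons (ne_well (by omega)) <| levels_cons (ne_high (by omega)) <| levels_nil _ _ _) (by omega)

/-- **Cover of the staircase cell**: every residue `x < p` is a level class of one of the 18 types. -/
theorem cover (hsn : 2 * n ≤ s * n) (hA : s * n + 8 * n < p) (hB : p < s * n + 9 * n) :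
    Cover (bTop s n) p
      [([1, -5, 1], true), ([1, -6, 1], false), ([1, -6], false), ([1, -5], false), ([1, -4], false),
      ([1, -3], false), ([0, -3], false), ([0, -2], false), ([-1, -2], false), ([-1, -1], true), ([-1, -1], false), ([-2, -1], false),
      ([-2, 0], false), ([-3, 0], false), ([-3, 1], false), ([-4, 1], false), ([-5, 1], false), ([-6, 1], false)] := by
  intro x hx
  by_cases c0 : x + 2 * p ≤ 3 * (s * n) + 16 * n
  · by_cases cc : 2 * x + 2 * p = 3 * (s * n) + 16 * n
    · exact ⟨([1, -5, 1], true), by decide, iv0c hsn hA hB hx c0 cc⟩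
    · exact ⟨([1, -6, 1], false), by decide, iv0 hsn hA hB hx c0 cc⟩
  by_cases c1 : x + p ≤ 2 * (s * n) + 8 * n
  · exact ⟨([1, -6], false), by decide, iv1 hsn hA hB hx (by omega) c1⟩
  by_cases c2 : x + p ≤ 2 * (s * n) + 9 * n
  · exact ⟨([1, -5], false), by decide, iv2 hsn hA hB hx (by omega) c2⟩
  by_cases c3 : x + p ≤ 2 * (s * n) + 10 * n
  · exact ⟨([1, -4], false), by decide, iv3 hsn hA hB hx (by omega) c3⟩
  by_cases c4 : x < s * n + 2 * n
  · exact ⟨([1, -3], false), by decide, iv4 hsn hA hB hx (by omega) c4⟩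
  by_cases c5 : x + p ≤ 2 * (s * n) + 11 * n
  · exact ⟨([0, -3], false), by decide, iv5 hsn hA hB hx (by omega) c5⟩
  by_cases c6 : x < s * n + 3 * n
  · exact ⟨([0, -2], false), by decide, iv6 hsn hA hB hx (by omega) c6⟩
  by_cases c7 : x + p ≤ 2 * (s * n) + 12 * n
  · exact ⟨([-1, -2], false), by decide, iv7 hsn hA hB hx (by omega) c7⟩
  by_cases c8 : x < s * n + 4 * n
  · by_cases cc : 2 * x + p = 3 * (s * n) + 16 * n
    · exact ⟨([-1, -1], true), by decide, iv8c hsn hA hB hx (by omega) c8 cc⟩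
    · exact ⟨([-1, -1], false), by decide, iv8 hsn hA hB hx (by omega) c8 cc⟩
  by_cases c9 : x + p ≤ 2 * (s * n) + 13 * n
  · exact ⟨([-2, -1], false), by decide, iv9 hsn hA hB hx (by omega) c9⟩
  by_cases c10 : x < s * n + 5 * n
  · exact ⟨([-2, 0], false), by decide, iv10 hsn hA hB hx (by omega) c10⟩
  by_cases c11 : x + p ≤ 2 * (s * n) + 14 * n
  · exact ⟨([-3, 0], false), by decide, iv11 hsn hA hB hx (by omega) c11⟩
  by_cases c12 : x < s * n + 6 * n
  · exact ⟨([-3, 1], false), by decide, iv12 hsn hA hB hx (by omega) c12⟩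
  by_cases c13 : x < s * n + 7 * n
  · exact ⟨([-4, 1], false), by decide, iv13 hsn hA hB hx (by omega) c13⟩
  by_cases c14 : x < s * n + 8 * n
  · exact ⟨([-5, 1], false), by decide, iv14 hsn hA hB hx (by omega) c14⟩
  exact ⟨([-6, 1], false), by decide, iv15 hsn hA hB hx (by omega)⟩

/-- The THEOREM-LB check of the 18 types at `(A, B) = (−3, 0)`, for either parity of `b₀`. -/
theorem checkLB_TY (odd : Bool) :
    checkLB odd
      [([1, -5, 1], true), ([1, -6, 1], false), ([1, -6], false), ([1, -5], false), ([1, -4], false),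
      ([1, -3], false), ([0, -3], false), ([0, -2], false), ([-1, -2], false), ([-1, -1], true), ([-1, -1], false), ([-2, -1], false),
      ([-2, 0], false), ([-3, 0], false), ([-3, 1], false), ([-4, 1], false), ([-5, 1], false), ([-6, 1], false)] (-3) 0 = true := by
  cases odd <;> decide

end Cell

/-! ## §4 The staircase cell theorem -/

/-- Window facts of the cell: `p ≥ 5`, `p ≤ b₀`, `p ≤ d = (2s+13)n`, `b₀ + 2 < p²`. -/
theorem cell_window {s n p : ℕ} (hsn : 2 * n ≤ s * n) (hA : s * n + 8 * n < p) (hB : p < s * n + 9 * n) :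
    5 ≤ p ∧ (p : ℤ) ≤ bTop s n 0 ∧ (p : ℤ) ≤ dOf (bTop s n) ∧ (bTop s n 0 + 2 : ℤ) < (p : ℤ) ^ 2 := by
  have hp11 : 11 ≤ p := by omega
  have hsq : 3 * (s * n) + 16 * n + 2 < p * p := by
    have : 11 * p ≤ p * p := Nat.mul_le_mul_right p hp11
    omega
  refine ⟨by omega, ?_, ?_, ?_⟩
  · rw [bTop_zero]; exact_mod_cast (show p ≤ 3 * (s * n) + 16 * n by omega)
  · rw [dOf_bTop]; exact_mod_cast (show p ≤ 2 * (s * n) + 13 * n by omega)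
  · rw [bTop_zero]
    have h := hsq
    zify at h
    push_cast
    nlinarith [h]

/-- **THE STAIRCASE CELL OF THE TOP FAMILY IS A THEOREM.**  For `s ≥ 2`, `n ≥ 1` and every prime `p` with
`(s+8)n < p < (s+9)n`:  `v_p(Cas₇(bTop s n)) ≥ −3` — the exponent the OBSERVED staircase law requires at this level
(Brown–Zudilin's (28)+(30) needs only `−4` here).  Digit-free: THEOREM LB + the class-type cover of §3. -/
theorem stairTop_cell (s n p : ℕ) (hs : 2 ≤ s) (hn : 1 ≤ n) (hp : p.Prime) (hA : s * n + 8 * n < p)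
    (hB : p < s * n + 9 * n) (hne : casoratian (bTop s n) 7 ≠ 0) :
    (-3 : ℤ) ≤ padicValRat p (casoratian (bTop s n) 7) := by
  haveI : Fact p.Prime := ⟨hp⟩
  have hsn : 2 * n ≤ s * n := Nat.mul_le_mul_right n hs
  obtain ⟨hp5, -, hpd, hwin⟩ := cell_window hsn hA hB
  have hv : casLB (bTop s n) p ≤ padicValRat p (casoratian (bTop s n) 7) :=
    casoratianClassBound_holds (bTop s n) 7 p (inPolytope_bTop s n) (by norm_num) (by norm_num)
      (inPolytope_shift_bTop s hn) hp hp5 hwin hne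
  rcases casLB_ge_of_cover (cover hsn hA hB) (checkLB_TY _) (by norm_num) hpd with h0 | h
  · rw [h0] at hv; exact le_trans (by norm_num) hv
  · linarith

/-- **TOP_STAIR #1** (`a = (7,13,9,12,11,15,17,12)`, dual ray `n·(34; 14,…,8)`): for every `n ≥ 1` and every prime
`14n < p < 15n`, `v_p(Cas₇) ≥ −3` (exact audit: `= −3` at all 136 such primes with `n ≤ 40`). -/
theorem stairTopOne_cell (n p : ℕ) (hn : 1 ≤ n) (hp : p.Prime) (hA : 14 * n < p) (hB : p < 15 * n)
    (hne : casoratian (bTop 6 n) 7 ≠ 0) : (-3 : ℤ) ≤ padicValRat p (casoratian (bTop 6 n) 7) :=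
  stairTop_cell 6 n p (by norm_num) hn hp (by omega) (by omega) hne

/-- **TOP_STAIR #9** (`a = (8,14,10,13,12,16,18,13)`, dual ray `n·(37; 15,…,9)`): for every `n ≥ 1` and every prime
`15n < p < 16n`, `v_p(Cas₇) ≥ −3` (exact audit: `= −3` at all 133 such primes with `n ≤ 40`). -/
theorem stairTopNine_cell (n p : ℕ) (hn : 1 ≤ n) (hp : p.Prime) (hA : 15 * n < p) (hB : p < 16 * n)
    (hne : casoratian (bTop 7 n) 7 ≠ 0) : (-3 : ℤ) ≤ padicValRat p (casoratian (bTop 7 n) 7) :=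
  stairTop_cell 7 n p (by norm_num) hn hp (by omega) (by omega) hne

/-! ## §5 The statement-file cells BY NAME -/

/-- **`StaircaseCells.StairTopFamilyCell` is a theorem** (all `s ≥ 2`, `n ≥ 1`). -/
theorem stairTopFamilyCell_holds : StairTopFamilyCell :=
  fun s n p hs hn hp hA hB hne => stairTop_cell s n p hs hn hp hA hB hne

/-- **`StaircaseCells.StairCellTS1` is a theorem**: the staircase cell of TOP_STAIR #1 `(7,13,9,12,11,15,17,12)`. -/
theorem stairCellTS1_holds : StairCellTS1 :=
  fun n p hn hp hA hB hne => stairTopOne_cell n p hn hp hA hB hne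

/-- **`StaircaseCells.StairCellTS9` is a theorem**: the staircase cell of TOP_STAIR #9 `(8,14,10,13,12,16,18,13)`. -/
theorem stairCellTS9_holds : StairCellTS9 :=
  fun n p hn hp hA hB hne => stairTopNine_cell n p hn hp hA hB hne

end Summit.KontsevichZagierPeriods.Zeta5Search.StairTop
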